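import Literature.NumberTheory.Rogawski1990.CohomologicalFinComponentIsTheta
import Literature.NumberTheory.Automorphic.UnitaryGroupPlaceInclusion
import Literature.NumberTheory.Automorphic.Liu2021.Def411WeilCarriersLocalIsotypyAtPlace
import Literature.NumberTheory.Automorphic.Liu2021.Def411WeilCarriersLocalTypesOfEquiv
import Literature.NumberTheory.Automorphic.UnitaryGroupLocalCongr
import Literature.RepresentationTheory.Liu2021.GlobalOscillatorIsomorphismCriterion
import Literature.NumberTheory.GelbartRogawski1991.FiniteAdelicWeilCentralCoinvariantsIsotypic
import Literature.NumberTheory.Automorphic.IrreducibleClassesComap                     -- ★ `IrrClass.comap`, `comap_surjective`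
import Literature.NumberTheory.Rogawski1990.GlobalAPacketLetters                          -- ★ p812883 (typ3 round 2): the named fact S2♭ `cohDiscrete_memXiFamily` (BY NAME)
import Literature.NumberTheory.GelbartRogawski1991.XiEnvelopeNonsplitThetaType         -- ★ D7α (F0-typ3 (g5)): the PRINT letter `xiEnvelope_nonsplit_isThetaType` (BY NAME, v1.2)
import Literature.NumberTheory.GelbartRogawski1991.WeilLiftNonsplitPrincipalSeriesConstituent  -- ★ p818501 U′-N (F0-typ1 (g5)): the PRINT letter `GR91Lemma512NonsplitAsPrinted` (BY NAME, v1.4)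
import Summits.HodgeConjecture.HodgeConjecture.Theorems.F0P2iGRDWitness                      -- p819322 (F0P2-p01 (g5)): DICT-CHOICE witness `grdMu`, `grdChi` + pins (v1.4)
import Summits.HodgeConjecture.HodgeConjecture.Theorems.F0P2iGRDAssembly                     -- A-p17 (g15): pinned GRD core `grdMatrix_grdMu_grdChi_of_GR91N` (v1.4)
import Summits.HodgeConjecture.HodgeConjecture.Theorems.F0P3CompactTrivOfRecord                 -- ★ p819716 (F0P3): `cmCompactFactor_rightRegular_eq_self_of_isHolOrAntihol` (compact factor acts trivially on a cotangent `P`)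
import Literature.RepresentationTheory.HarrisKudlaSweet1996.SplittingCharactersCM                   -- ★ `IsSplittingChar.exists_hasUnitaryArchType` (μω's unitary archimedean type, odd at m = 1)
import Summits.HodgeConjecture.HodgeConjecture.Theorems.F0P2iRIGinfDischarge                 -- ★ p819114 (B-p18 (g26)): `rigInf_node_of_xiArchPinned` over ★ `XiArchPinned` p818382 + ★ `stubRIGinfArith_holds` p818525 (v1.4)
import Summits.HodgeConjecture.CorCM.B01.Transposition.Item6OmegaChiSplitting           -- `OmegaChiSplitting.chiLocalSplittingsD` (★ B01)
import Summits.HodgeConjecture.HodgeConjecture.Theorems.F0P2cOmegaLocalType              -- ★ p803803 F0P2-p01 (g3): CE-L `formCongr_frame`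
import Summits.HodgeConjecture.HodgeConjecture.Theorems.F0P3MemXiFamilyTransfer          -- ★ F0P3-p04 (g5): `exists_muOmega`; imports ★ T♭-core `smoothConstituents_iff_of_hasFinComponent`
import Summits.HodgeConjecture.HodgeConjecture.Theorems.F0P3SLayerFoldShapes             -- ★ F0P3-p03 (g5): token producer `exists_cohToken_of_isHolOrAntihol_cpt`
import Summits.HodgeConjecture.HodgeConjecture.Theorems.F0P2cStubCLLocalTypeExists       -- ★ CL (rung 2, CE side): LOCAL TYPES EXIST `stubCL_holds` (Flath) — LTY-τ BY NAME
import Summits.HodgeConjecture.HodgeConjecture.Theorems.F0P2hLTYLocalConstituents        -- ★ p816375 (F0P2-p01 (g5)): LTY-c `exists_member_isConstituentOf_localType` — LTY BY NAME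
import HarnessLib

/-!
# Crux `H413` · programme P2 · PKΠ FROM THE THREE LETTERS — the rung-4 chain as ONE Lines-free ★ constant:
# `pkPi_of_letters (hS2 : ‹S2♯ in P3's C2♯ shape›) (hGR : GR91Lemma512NonsplitAsPrinted) (hD7 : xiEnvelope_nonsplit_isThetaType) : ‹PKΠ›`

Cell hodgecm-mathlib (D-0151), FLOOR 0, crux item H413 = stmt-HodgeConjecture-24833 (`HCCMUnconditional.H413` ⇐ socket 27455 `F0HdictE` ⇐ `stub_PK_localThetaClasses`
⇐ ★ `F0P2gPKOfRung3.stubPK_of_PKPi` ⇐ PKΠ).  PROVER FILE (A-p17 (g15); F0P2-plan (g6) ROW «PKΠ-OF-LETTERS» 10:09:36Z), THEOREMS ONLY, kernel lane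
`--supports stmt-HodgeConjecture-24833 --as helper`; never imports a `Cruxes/…/Lines` module (O50-1).  HONEST LABEL: HC_CM is proved only modulo the printed
citations until rung 0 closes; this file proves PKΠ — the ENGINE letter of programme P2 (sub-line `Cruxes/H413/Lines/F0_P2PKRung3.lean` v1.2 :323
`stub_PKPi_placewiseMembership`, re-cut by `Lines/F0_P2PKPiRung4.lean` v1.1∕v1.2) — MODULO EXACTLY THREE PRINTED∕PRINT-DERIVED LETTERS taken as hypotheses:
* `hS2 : ‹S2♯›` — programme P3's letter «a COTANGENT discrete `P` of `U(H)` lies in the ξ-local family of a one-dimensional automorphic `ξ` of `U(2)×U(1)`, with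
  `ξ_∞` pinned against `μω`'s archimedean type» [Rogawski1990 Thm. 13.3.6 (c), 14.6.4, Prop. 15.2.1 (b)]; TYPED HERE in P3's (C2♯) shape = the P2 desk's `C2SharpLetter` (v1.4 draft r4 §1, 687df90c; F0P3-plan 10:16:00Z) VERBATIM: cotangent `P` + compact-factor
  triviality + a cohomological `(𝔤,K)`-token ⟹ `∃ ξ, MemXiFamily P … ξ ∧ ∀ k, μω.HasUnitaryArchType k 0 → ∀ ι′, ξ.IsCohTrivialAt (tOfArchType k ι′) ι′` — the binder
  type is replaced by P3's FQN (`cohDiscrete_memXiFamily_archPinned`) in ED. 2 the hour that letter lands ★ (one-token edit); the desk's 6-line adapter to its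
  export shape (token ★ `exists_cohToken_of_isHolOrAntihol_cpt`, compact factor ★ p819716, `k` ★ `IsSplittingChar.exists_hasUnitaryArchType`) is INLINED;
* `hGR : GR91Lemma512NonsplitAsPrinted` — ★ p818501, PRINT row U′-N (director s515 (2)): the non-split half of the Gelbart–Rogawski dictionary
  [GelbartRogawski1991 (5.1.1), Lem. 5.1.2];
* `hD7 : xiEnvelope_nonsplit_isThetaType` — ★ p818350, PRINT row D7α (director s511∕s514 (2)∕s522): non-split rigidity in theta currency
  [Rogawski1990 Thm. 13.3.6 (c), 13.3.7; GelbartRogawski1991 Prop. 5.2.2].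
Everything else is ★ IN-HOUSE and consumed BY NAME: Rogawski's `μω` (★ `exists_muOmega`, Hewitt–Ross), the DICT-CHOICE witness `(μ_ξ, χ_f) := (grdMu, grdChi)`
(★ p819322: conjugate-symplectic, continuous, unitary, pins), the finite dictionary at the witness (★ p819573 `grdMatrix_grdMu_grdChi_of_GR91N`, over ★ (S)
p817998∕p819496, ★ GRD-LOC p817805∕p819096, ★ vocabulary p818127 + bridge p818933), RIG∞ = weight one of `μ_ξ` + automorphy of `χ_f` (★ p819114
`rigInf_node_of_xiArchPinned` over ★ `XiArchPinned` p818382 + ★ RIG∞-ARITH p818525 + ★ glue p819050), LTY at split places (★ CL `stubCL_holds` + ★ LTY-c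
`exists_member_isConstituentOf_localType` p816375).  The proof is the v1.4 head of the sub-line (F0P2-plan (g6)) TRANSCRIBED into ★-only currency; the
Lines↔Literature junctions (`ThetaTypeAt`∕`IsoAtXf` vs `ThetaTypeAtCM`∕`IsoAtXfCM`) go through the ★ bridges `thetaTypeAt_iff_CM`∕`isoAtXf_iff_CM` (`.mpr`).

VALUE (desk 10:09:36Z): the rung-4 chain as ONE ★ Theorems constant (TRIO modulo the three hypotheses, importable); the day-X fold of rung 3's live sorry is
then `stub_PKPi_placewiseMembership := F0P2jPKPiOfLetters.pkPi_of_letters stub_S2sharp stub_GR91N stub_D7α` BY NAME; and an independent elaboration of the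
v1.4 head.  The conclusion is PKΠ = `F0P2PKRung3.StubPKPiPlacewiseMembership` (v1.2 :176–217) = `F0P2PKPiRung4.PKPiTarget` VERBATIM.  No `def`, no `sorry`.

## References
* [Rogawski1990] J. Rogawski, Ann. of Math. Stud. 123 (1990): §12.2 (2) p. 174; §12.3 Prop. 12.3.3 p. 178; §13.1 p. 199, Prop. 13.1.3 (d); §13.3 Thm. 13.3.6 (c),
  13.3.7; §14.6 Thm. 14.6.4; Prop. 15.2.1 (b); Lemma 4.13.1 (b) p. 62.
* [GelbartRogawski1991] S. Gelbart, J. Rogawski, Invent. Math. 105 (1991): §5.1 (5.1.1) p. 465, Lemma 5.1.2 pp. 465–466; Prop. 5.2.2 p. 467.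
* [Liu2021] Y. Liu, arXiv:2102.11518: Def. 4.11–4.12, Prop. 4.13 (Case 1), App. D §D.1.
* [Kudla1994] Thm. 3.1; [Minguez2008] Thm. 1; [FlathCorvallis1979] Thm. 2.
-/

set_option autoImplicit false
-- the (𝔤,K)-token binders of S2♯ speak of `(uFormGroup (Fin 2) (Fin 1)).lie →ₗ⁅ℝ⁆ Module.End ℂ M` (as ★ `GlobalAPacketLetters` does)
attribute [local instance 100] LieRing.ofAssociativeRing
-- the mandated namespace has the single-problem summit's repeated segment (`HodgeConjecture.HodgeConjecture`)
set_option linter.dupNamespace false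

noncomputable section

open NumberField MeasureTheory IsDedekindDomain
open scoped Matrix ComplexOrder


namespace Summit.HodgeConjecture.HodgeConjecture.Cruxes.H413.F0P2jPKPiOfLetters


open Literature.NumberTheory Literature.NumberTheory.Automorphic Literature.NumberTheory.Automorphic.UnitaryGroup
open Literature.NumberTheory.Automorphic.UnitaryGroup.CotangentForms
open Literature.NumberTheory.Automorphic.IdeleClassGroup
open Literature.NumberTheory.Automorphic.Liu2021 Literature.NumberTheory.Automorphic.Liu2021.Def411WeilCarriers
open Literature.NumberTheory.Automorphic.Liu2021.Def411WeilCarriersDoubling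
open Literature.NumberTheory.GelbartRogawski1991 Literature.NumberTheory.GelbartRogawski1991.UnitaryDualPair
open Literature.NumberTheory.GelbartRogawski1991.UnitaryDualPair.WeilCoinv
open Literature.RepresentationTheory Literature.RepresentationTheory.Liu2021
open Literature.NumberTheory.GaloisRepresentations
open Literature.NumberTheory.Rogawski1990
open Summit.HodgeConjecture.CorCM.Transposition
open Literature.RepresentationTheory.BorelWallach2000
open Literature.RepresentationTheory.KonnoKonno2007 Literature.RepresentationTheory.KonnoKonno2007.RealDualPair
open Literature.RepresentationTheory.KonnoKonno2007.RealDualPair.UForm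
open Summit.HodgeConjecture.HodgeConjecture.Cruxes.H413.F0P3MemXiFamilyTransfer
open Summit.HodgeConjecture.HodgeConjecture.Cruxes.H413.F0P3SLayerFoldShapes
open Summit.HodgeConjecture.HodgeConjecture.Cruxes.H413.F0P2cStubCLLocalTypeExists
open Summit.HodgeConjecture.HodgeConjecture.Cruxes.H413.F0P2hLTYLocalConstituents


set_option synthInstance.maxHeartbeats 400000 in
set_option maxHeartbeats 16000000 in
/-- **PKΠ FROM THE THREE LETTERS S2♯ + GR91N + D7α** — for a cotangent discrete `P` of `U(H)` with finite component `σ` (irreducible, smooth, admissible):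
∃ `μ` conjugate-symplectic of WEIGHT ONE and `χ ∈ Chi` such that at EVERY finite place `v` some line class `ε_v` makes `σ ∘ inclPlace v` `X_v(μ, ε_v, χ) ∘ κ_v⁻¹`-isotypic
(PKΠ VERBATIM).  Proof (the v1.4 head in ★ currency): `μω` from ★ `exists_muOmega`; `hS2` (fed the ★ token, ★ compact-factor triviality) gives `ξ` with `MemXiFamily P … ξ` and, at a unitary archimedean type `k` of `μω` (★, odd), the arch pin `XiArchPinned L ξ μω k`;
the witness `(grdMu, grdChi)` (★ p819322); its finite dictionary `hm := grdMatrix_grdMu_grdChi_of_GR91N hGR …` (★ p819573); `⟨hw, haut⟩ := rigInf_node_of_xiArchPinned …`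
(★ p819114); split `v`: ★ `stubCL_holds` + ★ `exists_member_isConstituentOf_localType` + `hm.1`, read back through ★ `thetaTypeAt_iff_CM`; non-split `v`: `hD7 … hm v hv`,
read back through ★ `isoAtXf_iff_CM`. [cite: Rogawski1990, Thm. 13.3.6 (c), §13.1 p. 199, Prop. 15.2.1 (b)] [cite: GelbartRogawski1991, §5.1 (5.1.1), Lem 5.1.2 p. 466, Prop. 5.2.2]
[cite: Liu2021, Def. 4.11, Prop. 4.13 (Case 1)] -/
theorem pkPi_of_letters
    (hS2 :
      ∀ (L : Type) [Field L] [NumberField L] [IsCMField L] (ι : L →+* ℂ) (H : Matrix (Fin 3) (Fin 3) L) (T : GL (Fin 3) ℂ)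
        (hT : (T : Matrix (Fin 3) (Fin 3) ℂ)ᴴ * H.map ι * (T : Matrix (Fin 3) (Fin 3) ℂ) = Literature.Geometry.ComplexHyperbolic.BallModel.J),
        (∀ τ' : L →+* ℂ, InfinitePlace.mk τ' ≠ InfinitePlace.mk ι → (H.map τ').PosDef) →
        2 ≤ Module.finrank ℚ ↥(maximalRealSubfield L) →
        ∀ (μ : Measure (adelicGroupData (↥(maximalRealSubfield L)) L (IsCMField.complexConj L) 3 H).automorphicQuotient)
          [(adelicGroupData (↥(maximalRealSubfield L)) L (IsCMField.complexConj L) 3 H).IsAutomorphicMeasure μ]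
          (μω : HeckeCharacter L) (hμu : μω.IsUnitary),
          (∀ x : Literature.NumberTheory.GaloisRepresentations.ideleGroup ↥(maximalRealSubfield L),
            μω (AdeleRing.ideleBaseChange (↥(maximalRealSubfield L)) L x) = quadraticHeckeCharCM L x) →
        ∀ (P : DiscreteAutomorphicRep (adelicGroupData (↥(maximalRealSubfield L)) L (IsCMField.complexConj L) 3 H) μ),
              (P.IsHolCotangentAt (cmArchSection L ι H T hT) (cmCompactFactor L ι H T hT) ∨
                P.IsAntiholCotangentAt (cmArchSection L ι H T hT) (cmCompactFactor L ι H T hT)) →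
              (∀ k : (adelicGroupData (↥(maximalRealSubfield L)) L (IsCMField.complexConj L) 3 H).Adelic, k ∈ cmCompactFactor L ι H T hT → ∀ v : P.space.toSubmodule, (adelicGroupData (↥(maximalRealSubfield L)) L (IsCMField.complexConj L) 3 H).rightRegular μ k (v : (adelicGroupData (↥(maximalRealSubfield L)) L (IsCMField.complexConj L) 3 H).L2 μ) = v) → ∀
              (M : Type) [AddCommGroup M] [Module ℂ M]
              (σK : Representation ℂ (uFormGroup (Fin 2) (Fin 1)).maximalCompact M) (σ𝔤 : (uFormGroup (Fin 2) (Fin 1)).lie →ₗ⁅ℝ⁆ Module.End ℂ M)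
              (hM : IsGKModule (uFormGroup (Fin 2) (Fin 1)) σK σ𝔤), IsIrreducibleGK σK σ𝔤 →
              (∃ T₁ : P.archModuleCM ι T hT →ₗ[ℂ] M,
                (∀ (k : (uFormGroup (Fin 2) (Fin 1)).maximalCompact) (w : P.archModuleCM ι T hT), T₁ (P.archRepKCM ι T hT k w) = σK k (T₁ w)) ∧
                  (∀ (X : (uFormGroup (Fin 2) (Fin 1)).lie) (w : P.archModuleCM ι T hT), T₁ (P.archRepLieCM ι T hT X w) = σ𝔤 X (T₁ w)) ∧ T₁ ≠ 0) →
              ∀ δ : ℤ, (δ = 1 ∨ δ = -1) → upqTypeClasses σK σ𝔤 hM.ad_compat 1 δ ≠ ⊥ →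
                ∃ ξ : OneDimAutRepH L, MemXiFamily P (transpose_map_cmConjRingHom_eq_of_frame L ι H T hT) (isUnit_det_of_frame L ι H T hT) μω hμu ξ ∧
                  ∀ k : InfinitePlace L → ℤ, μω.HasUnitaryArchType k (fun _ => 0) → ∀ ι' : L →+* ℂ, ξ.IsCohTrivialAt (ArchSignRecipe.tOfArchType k ι') ι')
    (hGR : Literature.NumberTheory.GelbartRogawski1991.GR91Lemma512NonsplitAsPrinted)
    (hD7 : Literature.NumberTheory.GelbartRogawski1991.xiEnvelope_nonsplit_isThetaType) :
  ∀ (L : Type) [Field L] [NumberField L] [IsCMField L] (ι : L →+* ℂ) (H : Matrix (Fin 3) (Fin 3) L) (T : GL (Fin 3) ℂ)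
    (hT : (T : Matrix (Fin 3) (Fin 3) ℂ)ᴴ * H.map ι * (T : Matrix (Fin 3) (Fin 3) ℂ) = Literature.Geometry.ComplexHyperbolic.BallModel.J),
    (∀ τ' : L →+* ℂ, InfinitePlace.mk τ' ≠ InfinitePlace.mk ι → (H.map τ').PosDef) → 2 ≤ Module.finrank ℚ ↥(maximalRealSubfield L) →
    ∀ {n' : ℕ} (e₁ : Fin 3 × Fin 1 ≃ Fin n') (dV : Fin 3 → L) (hdV : ∀ i, IsCMField.complexConj L (dV i) = dV i)
      (hdV0 : ∀ i, dV i ≠ 0) (g : GL (Fin 3) L)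
      (hg : ((g : Matrix (Fin 3) (Fin 3) L).map (cmConjRingHom L))ᵀ * H * (g : Matrix (Fin 3) (Fin 3) L) = Matrix.diagonal dV)
      (ιV : finAdelic (↥(maximalRealSubfield L)) L (IsCMField.complexConj L) 3 H →*
          finAdelic (↥(maximalRealSubfield L)) L (IsCMField.complexConj L) 3 (Matrix.diagonal dV)),
        (∀ k, ((ιV k : finAdelic (↥(maximalRealSubfield L)) L (IsCMField.complexConj L) 3 (Matrix.diagonal dV)) :
            GL (Fin 3) (FiniteAdeleRing (𝓞 L) L)) =
          (toFinAdeleGL L 3 g)⁻¹ * (k : GL (Fin 3) (FiniteAdeleRing (𝓞 L) L)) * toFinAdeleGL L 3 g) →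
        ∀ (μ : Measure (adelicGroupData (↥(maximalRealSubfield L)) L (IsCMField.complexConj L) 3 H).automorphicQuotient)
          [(adelicGroupData (↥(maximalRealSubfield L)) L (IsCMField.complexConj L) 3 H).IsAutomorphicMeasure μ]
          (W : Type) [AddCommGroup W] [Module ℂ W]
          (σ : Representation ℂ (finAdelic (↥(maximalRealSubfield L)) L (IsCMField.complexConj L) 3 H) W),
          σ.IsIrreducible → σ.IsSmooth → σ.IsAdmissible →
          ∀ P : DiscreteAutomorphicRep (adelicGroupData (↥(maximalRealSubfield L)) L (IsCMField.complexConj L) 3 H) μ,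
            (P.IsHolCotangentAt (cmArchSection L ι H T hT) (cmCompactFactor L ι H T hT) ∨
              P.IsAntiholCotangentAt (cmArchSection L ι H T hT) (cmCompactFactor L ι H T hT)) →
            P.HasFinComponent σ →
            ∃ (μ : Literature.NumberTheory.Automorphic.IdeleClassGroup L →ₜ* Circle) (hμ : IsConjugateSymplectic L μ), HasWeight L μ 1 ∧
              ∃ (χ : Chi (↥(maximalRealSubfield L)) L (IsCMField.complexConj L)),
                ∀ (v : HeightOneSpectrum (𝓞 ↥(maximalRealSubfield L))), ∃ εv : (↥(maximalRealSubfield L))ˣ,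
                    isotypicComponent (MonoidAlgebra ℂ (localPi L (IsCMField.complexConj L) 3 H v))
                      (Representation.asModule (σ.comp (inclPlace (↥(maximalRealSubfield L)) L (IsCMField.complexConj L) 3 H v)))
                      (Representation.asModule
                        (((show Representation ℂ (localPi L (IsCMField.complexConj L) 3 (Matrix.diagonal dV) v) _ from
                          (TwistedCoinv.rep (localCharOfCenter (↥(maximalRealSubfield L)) L (IsCMField.complexConj L)
                              (JW (↥(maximalRealSubfield L)) L εv) (JW_apply_ne_zero (↥(maximalRealSubfield L)) L εv) χ.1 v)
                            ((OmegaChiSplitting.chiLocalSplittingsD ⟨L⟩ e₁ dV hdV hdV0 (toHeckeCharacter L μ)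
                              ((isOscillatorChar_toHeckeCharacter_iff μ).mpr hμ) εv).omegaLoc v)
                            (commute_omegaLoc_localCenter (↥(maximalRealSubfield L)) L (IsCMField.complexConj L) 3 e₁ (Matrix.diagonal dV)
                              (JW (↥(maximalRealSubfield L)) L εv) (complexConj_imagUnit L) (imagUnit_ne_zero L) (imagUnit_mul_self L)
                              (realDiagonal_isSymm L dV hdV) (isSymm_TW (↥(maximalRealSubfield L)) εv) (realDiagonal_map L dV hdV).symm
                              (JW_eq (↥(maximalRealSubfield L)) L εv) (JW_apply_ne_zero (↥(maximalRealSubfield L)) L εv)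
                              (OmegaChiSplitting.chiLocalSplittingsD ⟨L⟩ e₁ dV hdV hdV0 (toHeckeCharacter L μ)
                                ((isOscillatorChar_toHeckeCharacter_iff μ).mpr hμ) εv) v)).comp
                            (UnitaryGroup.localLineInl L (IsCMField.complexConj L) 3 e₁ (Matrix.diagonal dV) (JW (↥(maximalRealSubfield L)) L εv) v)) :
                            localPi L (IsCMField.complexConj L) 3 (Matrix.diagonal dV) v →* _).comp
                          (localCongr L (IsCMField.complexConj L) g one_ne_zero
                            (F0P2cOmegaLocalType.formCongr_frame L H dV g hg) v).symm.toMulEquiv.toMonoidHom)) = ⊤ := by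
  intro L _ _ _ ι H T hT hdef h2 n' e₁ dV hdV hdV0 g hg ιV hιV μ _ W _ _ σ hirr hsm hadm P hP hfin
  obtain ⟨μω, hμu, hquad⟩ := exists_muOmega L
  -- S2♯ in P3's (C2♯) shape: feed it the cohomological token of the cotangent `P` (★ `exists_cohToken_of_isHolOrAntihol_cpt`) and the triviality of the
  -- compact factor (★ p819716), then pin `ξ_∞` against ANY unitary archimedean type `k` of `μω` (★ `IsSplittingChar.exists_hasUnitaryArchType`; odd since `m = 1`)
  obtain ⟨M, iM₁, iM₂, σK, σ𝔤, hM, δ, hδ, hirrGK, hT₁, hne⟩ := exists_cohToken_of_isHolOrAntihol_cpt L ι H T hT μ hdef h2 P hP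
  have hKc := F0P3CompactTrivOfRecord.cmCompactFactor_rightRegular_eq_self_of_isHolOrAntihol L ι H T hT P hP
  obtain ⟨ξ, hmem, hall⟩ := @hS2 L _ _ _ ι H T hT hdef h2 μ _ μω hμu hquad P hP hKc M iM₁ iM₂ σK σ𝔤 hM hirrGK hT₁ δ hδ hne
  have hsχ : HarrisKudlaSweet1996.IsSplittingChar L 1 μω := (HarrisKudlaSweet1996.isSplittingChar_iff_of_odd odd_one μω).2 hquad
  obtain ⟨k, hk, hmod⟩ := hsχ.exists_hasUnitaryArchType hμu
  have hodd : ∀ w : InfinitePlace L, Odd (k w) := fun w => Int.odd_iff.2 (by simpa [Int.ModEq] using hmod w)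
  have hpin : XiArchPinned L ξ μω k := ⟨hk, hodd, hall k hk⟩
  have hμ1 : IsConjugateSymplectic L (F0P2iGRDWitness.grdMu L ξ μω hμu) :=
    F0P2iGRDWitness.isConjugateSymplectic_grdMu L ξ μω hμu hquad
  have hcont : Continuous (F0P2iGRDWitness.grdChi L ξ μω hquad) := F0P2iGRDWitness.continuous_grdChi L ξ μω hquad
  have hunit : ∀ z, ‖((F0P2iGRDWitness.grdChi L ξ μω hquad z : ℂˣ) : ℂ)‖ = 1 := F0P2iGRDWitness.norm_grdChi_apply L ξ hμu hquad
  -- the finite Gelbart–Rogawski dictionary at the witness, from the PRINT letter U′-N (★ p819573; `GRDMatrixCM` currency)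
  have hm := F0P2iGRDAssembly.grdMatrix_grdMu_grdChi_of_GR91N hGR L H (transpose_map_cmConjRingHom_eq_of_frame L ι H T hT)
    (isUnit_det_of_frame L ι H T hT) e₁ dV hdV hdV0 g hg ξ μω hμu hquad
  -- RIG∞: weight one of `μ_ξ` and automorphy of `χ_f` (★ p819114, in-house)
  obtain ⟨hw, haut⟩ := F0P2iRIGinfDischarge.rigInf_node_of_xiArchPinned L ξ μω k hpin (F0P2iGRDWitness.grdMu L ξ μω hμu)
    (F0P2iGRDWitness.toHeckeCharacter_grdMu L ξ μω hμu) (F0P2iGRDWitness.grdChi L ξ μω hquad)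
    (F0P2iGRDWitness.grdChi_finAdelicCheck L ξ μω hquad (complexConj_mul_complexConj' L))
  refine ⟨F0P2iGRDWitness.grdMu L ξ μω hμu, hμ1, hw, ⟨F0P2iGRDWitness.grdChi L ξ μω hquad, haut⟩, fun v => ?_⟩
  by_cases hs : ∃ w : PlacesOver L v, IsCMField.complexConj L • w.1 ≠ w.1
  · -- SPLIT place: LTY BY NAME (★ CL `stubCL_holds`: a local type `τ` exists; ★ p816375: some member `c ∈ Pv v` is carried by `τ`) + (S) at the witness
    obtain ⟨T₀, iT₁, iT₂, τ, hτ, htop⟩ :=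
      stubCL_holds (↥(maximalRealSubfield L)) L (IsCMField.complexConj L) 3 H W σ hirr hadm v
    obtain ⟨Pv, hfam, hmemτ⟩ := exists_member_isConstituentOf_localType P hirr hsm hfin hmem
    obtain ⟨c, hc, hconst⟩ := hmemτ v T₀ τ hτ htop
    obtain ⟨ε, hΘ⟩ := hm.1 Pv hfam v hs c hc
    exact ⟨ε, (F0P2iVocabularyBridge.thetaTypeAt_iff_CM L H e₁ dV hdV hdV0 g hg (F0P2iGRDWitness.grdMu L ξ μω hμu) hμ1
      (F0P2iGRDWitness.grdChi L ξ μω hquad) ε v c).mpr hΘ T₀ τ hτ hconst W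
        (σ.comp (inclPlace (↥(maximalRealSubfield L)) L (IsCMField.complexConj L) 3 H v)) htop⟩
  · -- NON-SPLIT place: the PRINT letter D7α at the witness and its dictionary
    push Not at hs
    obtain ⟨ε, hε⟩ := hD7 L H (transpose_map_cmConjRingHom_eq_of_frame L ι H T hT) (isUnit_det_of_frame L ι H T hT) e₁ dV hdV hdV0 g hg μ μω hμu
      hquad W σ hirr hsm hadm P hfin ξ hmem (F0P2iGRDWitness.grdMu L ξ μω hμu) hμ1 (F0P2iGRDWitness.grdChi L ξ μω hquad) hcont hunit hm v hs
    exact ⟨ε, (F0P2iVocabularyBridge.isoAtXf_iff_CM L H e₁ dV hdV hdV0 g hg σ (F0P2iGRDWitness.grdMu L ξ μω hμu) hμ1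
      (F0P2iGRDWitness.grdChi L ξ μω hquad) ε v).mpr hε⟩

end Summit.HodgeConjecture.HodgeConjecture.Cruxes.H413.F0P2jPKPiOfLetters

end
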